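import Literature.AnabelianGeometry.EtaleTheta.ThetaRootOrbitsMonodromyToyOrbit
import Literature.AnabelianGeometry.EtaleTheta.Discharge.Sec2ThetaOrbitTransportCalculus
import Literature.AnabelianGeometry.EtaleTheta.EqUpToRootOfUnityInstances
import Literature.AnabelianGeometry.EtaleTheta.ThetaRootOrbitsSchemaWitness
import Literature.AnabelianGeometry.EtaleTheta.ThetaRootOrbitsSchemaInhabited
import HarnessLib

/-!
# [EtTh] Cor. 2.8 (i) at the MONODROMY TOY, part B2 (PROOF-ONLY): clauses C1–C3 of the typed `Cor28_i` for EVERY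
# topological `Γ` («constant multiple rigidity at the toy»), and `¬ Cor28_i` via `γ_t` (clause C4; Def. 2.5 (i)(a) fails)

S. Mochizuki, *The étale theta function and its Frobenioid-theoretic manifestations* [EtTh], Publ. RIMS **45**
(2009), §2: Rmk. 2.1.1 p. 36 («`C̲ → C` fails to be Galois … no nontrivial automorphism ∈ Gal(X̲/X) of odd order
descends»), Def. 2.5 (i)(a) p. 39 («`Π̄_X ↠ Q` factors through the natural quotient `Π^tp_X ↠ Z`»), Def. 2.7 p. 41,
Cor. 2.8 (i) p. 42 (PRIMS text pages) [cite: MochizukiEtTh2009, Cor 2.8(i) p.42] [cite: MochizukiEtTh2009, Rmk 2.1.1 p.36]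
[cite: MochizukiEtTh2009, Def 2.5 p.39].  Cell `abc-iut`, F lane, FACT-LIST row F-0640 `ThetaOrbitData.Cor28_i`, seat
abc-iut-f-128 (gen 14); abc-iut-L2-lead R1504 (WELCOME, COUNT-NEUTRAL).  PROOF-ONLY sequel of part A
(`ThetaRootOrbitsMonodromyToy.lean`: the print-recipe orbit datum `thetaOrbitData l hl` over abc-iut-w6-d084's
`monodromyModel l hl`; HONEST LABEL R1352 DESIGNED TOY, verbatim there) and part B1 (`ThetaRootOrbitsMonodromyToyOrbit.lean`:
coordinates, `Δ_Θ ≅ ℤ/l` commutative, the `(Gal(Y/X) × μ₂)`-orbit and the intrinsic characterisation `mem_etaColl_iff`).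

RESULTS (`O := thetaOrbitData l hl`, every odd `l`; `Γ` ranges over ALL topological = all automorphisms of the infinite
discrete group `Π^tp_C = ((ℤ/l × ℤ/l) ⋊ D_∞) × ℤ/2`, `Γ_Θ` over the automorphisms of `Δ_Θ` it induces):
* §3 `transport_etaColl_eq`: EVERY admissible pair `(Γ, Γ_Θ)` (`InducesOnTheta`, `Γ(Π^tp_Ÿ) = Π^tp_Ÿ`) maps `η̈^{Θ,ℤ×μ₂}`
  onto itself — because `Γ_Θ` is `Γ`-induced, the restriction condition `η|_{Δ_Θ} = [·]^{±1}` is transport-invariant;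
  no automorphism census of `Π^tp_C` is needed.  Hence (§4) `IsStandard`, and clauses C1 (standard type preserved), C2
  (roots, order `l` — DEGENERATE: `Π^tp_{Ÿ̲̲} = 1`), C3 (`η̈^{Θ,ℤ×μ₂}` preserved up to order `1`, here EXACTLY) of the typed
  `Cor28_i` hold for every `Γ`, WITHOUT their tower-stability antecedents (`cor28_i_clauses_C1_C2_C3`).
* §5 clause C4 FAILS: `γ_t` = conjugation by the loop `t` stabilises the whole `C̲`-list `[Π^tp_{C̲}, Π^tp_{X̲}, Π^tp_X,
  Π^tp_Ÿ]` (`t ∈ Π^tp_{X̲} ⊆ Π^tp_{C̲}` in the toy), induces the identity on `Δ_Θ`, and translates `η₀` to `η_{1,1} ∉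
  {η₀^{±1}} = η̈^{Θ,l·ℤ×μ₂}`; «up to a root of unity of order 1» is literal equality here (abc-iut-f-161's
  `EqUpToRootOfUnity.eq_of_one`: `Δ_Θ` commutative, classes `∂`-saturated), so **`¬ (thetaOrbitData l hl).Cor28_i`**
  (`not_cor28_i`, `l ≠ 1`).  DIAGNOSIS (`not_def25Conditions`): the toy's `X̲ → X` kills the `a`-cycle, not the loop —
  Def. 2.5 (i)(a) `Π^tp_Y ⊆ Π^tp_{X̲}` (`TemperedCoverData.Def25Conditions`) is FALSE at `monodromyModel`, so print's
  Rmk. 2.1.1 obstruction («translation by `t` does not normalise `Π_{C̲}`») is absent and the `l·ℤ`-sub-orbit is not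
  protected.  The typed `Cor28_i` carries no Def. 2.5 hypothesis (by design of the interface: setting data live in §1),
  which is what this toy NEGATIVE exhibits — next to abc-iut-w4-d051's junk-collection refuter `not_forall_cor28_i`.

HONEST LABEL (abc-iut-L2-lead R1352, verbatim): «a DESIGNED tempered toy with print's monodromy combinatorics — loop ↦
`Δ̄^ell` (`b`-cycle), the inversion INVERTS it, unipotent monodromy `x ↦ x·z` on the `a`-cycle, `z` = cusp inertia = `Δ̄_Θ`
central; `G_K := 1`; NOT a Tate curve, NOT the tempered fundamental group of a curve; consistency ≠ faithfulness; nothing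
here takes a side on anything printed.»
HONEST FRAMING: statements about OUR typed predicate at a DESIGNED toy (`G_K = 1`, `Π^tp_{Ÿ̲̲} = 1`, finite `Π^tp_Ÿ`);
refutable-as-typed-at-a-design-carrier ≠ refuted in print ([EtTh] Cor. 2.8 (i) is a refereed theorem whose setting
satisfies Def. 2.5); the natural instance is abc-iut-L2's `ofEmbedding` at the cover of record (conditional closer
p516984 ⟸ `hη₁`; head form abc-iut-f-193 p537653 ⟸ `H`; unconditional ⟺ (E), parked R1429) — DISTINCT route, not
used here.  PROOF-ONLY (0 `def`, 0 `instance`, 0 notation).  No bearing on [IUTchIII] Cor. 3.12; no side taken; typed ≠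
proved; count-neutral for the L2 books (R1504).
-/

noncomputable section

namespace Literature.AnabelianGeometry.EtaleTheta.ThetaCovers.MonodromyModel

open Multiplicative HeisenbergWitness TemperedModel DihedralGroup ThetaOrbitData

variable (l : ℕ)

section Model

variable [NeZero l] (hl : Odd l)

/-- The conjugation action of `Π^tp_C` on the toy's `Δ_Θ` is trivial (`z` central). (toy bookkeeping)
[cite: MochizukiEtTh2009, Cor 2.8(i) p.42] -/
theorem act_eq_self (x : TG l) (a : DTh l) : (thetaOrbitData l hl).act x a = a := by
  induction a using QuotientGroup.induction_on with
  | H τ =>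
    rw [ThetaOrbitData.act_mk]
    congr 1
    exact Subtype.ext (conj_eq_of_mem_thetaTop l x τ.2)

/-! ## 3. Every admissible `(Γ, Γ_Θ)` maps `η̈^{Θ,ℤ×μ₂}` onto itself -/

/-- **Transport-invariance of `η̈^{Θ,ℤ×μ₂}` (⊆)**: for EVERY topological automorphism `Γ` of `Π^tp_C` stabilising `Π^tp_Ÿ`
and every `Γ_Θ` it induces on `Δ_Θ` (`InducesOnTheta`), the transport `η ↦ Γ_Θ⁻¹ ∘ η ∘ Γ` carries the orbit collection
into itself — it preserves multiplicativity and, `Γ_Θ` being `Γ`-induced, the restriction condition `η|_{Δ_Θ} = [·]^{±1}`.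
No automorphism census of `Π^tp_C` is used. (toy bookkeeping for [EtTh] Cor. 2.8 (i); no claim about print)
[cite: MochizukiEtTh2009, Cor 2.8(i) p.42] -/
theorem transport_etaColl_subset {Γ : TG l ≃ₜ* TG l}
    {ΓΘ : DTh l ≃* DTh l}
    (hind : (thetaOrbitData l hl).InducesOnTheta Γ ΓΘ) (hY : (PiYddT l).map Γ.toMulEquiv.toMonoidHom = PiYddT l) :
    (thetaOrbitData l hl).transport (PiYddT l) Γ hY ΓΘ (etaColl l) ⊆ etaColl l := by
  obtain ⟨hΓ, hmk⟩ := hind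
  rintro c ⟨c₀, hc₀, rfl⟩
  obtain ⟨η, rfl, hmul, σ, hσ, hres⟩ := (mem_etaColl_iff l c₀).mp hc₀
  beta_reduce
  rw [Set.image_singleton]
  refine (mem_etaColl_iff l _).mpr ⟨_, rfl, fun g h => ?_, σ, hσ, fun τ => ?_⟩
  · show ΓΘ.symm (η ⟨Γ ((g * h : ↥(PiYddT l)) : TG l), _⟩) = ΓΘ.symm (η ⟨Γ g, _⟩) * ΓΘ.symm (η ⟨Γ h, _⟩)
    rw [← map_mul ΓΘ.symm, ← hmul]
    congr 2
    apply Subtype.ext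
    show Γ ((g : TG l) * h) = Γ g * Γ h
    rw [map_mul]
  · have hτ' : Γ (τ : TG l) ∈ thetaTop l := hΓ.le (Subgroup.mem_map.mpr ⟨τ, τ.2, rfl⟩)
    have key : ∀ p, η ⟨Γ (τ : TG l), p⟩ = (QuotientGroup.mk (⟨Γ (τ : TG l), hτ'⟩ : ↥(thetaTop l)) : DTh l) ^ σ :=
      fun _ => hres ⟨Γ (τ : TG l), hτ'⟩
    show ΓΘ.symm (η ⟨Γ (τ : TG l), _⟩) = (QuotientGroup.mk τ : DTh l) ^ σ
    rw [key, map_zpow]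
    congr 1
    rw [MulEquiv.symm_apply_eq]
    exact (hmk τ).symm

/-- **Transport-invariance of `η̈^{Θ,ℤ×μ₂}` (=)**: every admissible `(Γ, Γ_Θ)` maps the `2l` classes onto themselves
(apply `⊆` to `Γ` and to `Γ⁻¹`). «Constant multiple rigidity at the toy» with trivial multiple. (toy bookkeeping for
[EtTh] Cor. 2.8 (i); no claim about print) [cite: MochizukiEtTh2009, Cor 2.8(i) p.42] -/
theorem transport_etaColl_eq {Γ : TG l ≃ₜ* TG l}
    {ΓΘ : DTh l ≃* DTh l}
    (hind : (thetaOrbitData l hl).InducesOnTheta Γ ΓΘ) (hY : (PiYddT l).map Γ.toMulEquiv.toMonoidHom = PiYddT l) :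
    (thetaOrbitData l hl).transport (PiYddT l) Γ hY ΓΘ (etaColl l) = etaColl l := by
  refine Set.Subset.antisymm (transport_etaColl_subset l hl hind hY) ?_
  have hY' := ThetaOrbitData.map_symm_eq (T := monodromyModel l hl) (PiYddT l) hY
  have hY'' := ThetaOrbitData.map_symm_eq (T := monodromyModel l hl) (PiYddT l) hY'
  have hsub := transport_etaColl_subset l hl hind.symm hY'
  have heq := (thetaOrbitData l hl).transport_symm_transport (PiYddT l) Γ.symm hY' hY'' ΓΘ.symm (etaColl l)
  intro c hc
  rw [← heq] at hc
  obtain ⟨c₁, hc₁, rfl⟩ := hc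
  exact ⟨c₁, hsub hc₁, rfl⟩

/-! ## 4. `IsStandard` and clauses C1, C2, C3 of the typed Cor. 2.8 (i) — for EVERY `Γ` -/

/-- **The toy datum is of standard type**: `η₀` restricted to `D = 1 ∈ Dtau` is killed by `2` (trivially — the standard
type notion is DEGENERATE at `G_K = 1`). (toy bookkeeping for [EtTh] Def. 2.7; no claim about print)
[cite: MochizukiEtTh2009, Def 2.7 p.41] -/
theorem isStandard_thetaOrbitData : (thetaOrbitData l hl).IsStandard := by
  refine ⟨⊥, Set.mem_singleton _, {etaFn l 1 0}, ⟨1, 0, Or.inl rfl, rfl⟩, etaFn l 1 0, Set.mem_singleton _,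
    (1 : DTh l), fun g hg => ?_⟩
  have hg1 : g = 1 := Subgroup.mem_bot.mp hg
  subst hg1
  rw [act_eq_self, mul_inv_cancel]
  show etaFn l 1 0 1 ^ 2 = 1
  rw [etaFn_one, one_pow]

/-- **Cor. 2.8 (i), clause C1, for EVERY `Γ`** at the toy: if `Γ_Θ` is `Γ`-induced, `Γ` permutes `Dtau` and stabilises
`Π^tp_Ÿ`, the transported `η̈^{Θ,ℤ×μ₂}` is of standard type (abc-iut-w6-d051's generic `isStandardColl_transport_etaZMu2`,
`Dtau` finite). (toy bookkeeping for [EtTh] Cor. 2.8 (i); no claim about print) [cite: MochizukiEtTh2009, Cor 2.8(i) p.42] -/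
theorem cor28_i_C1 {Γ : TG l ≃ₜ* TG l} {ΓΘ : DTh l ≃* DTh l}
    (hind : (thetaOrbitData l hl).InducesOnTheta Γ ΓΘ)
    (hD : ∀ D ∈ (thetaOrbitData l hl).Dtau, D.map Γ.toMulEquiv.toMonoidHom ∈ (thetaOrbitData l hl).Dtau)
    (hY : (PiYddT l).map Γ.toMulEquiv.toMonoidHom = PiYddT l) :
    (thetaOrbitData l hl).IsStandardColl ((thetaOrbitData l hl).transport _ Γ hY ΓΘ (thetaOrbitData l hl).etaZMu2) :=
  (thetaOrbitData l hl).isStandardColl_transport_etaZMu2 (Set.finite_singleton _) (isStandard_thetaOrbitData l hl)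
    hind hD hY

/-- The root collection `{1}` on `Π^tp_{Ÿ̲̲} = 1` is carried to itself by every transport. (toy bookkeeping)
[cite: MochizukiEtTh2009, Cor 2.8(i) p.42] -/
theorem transport_rootColl_eq (Γ : TG l ≃ₜ* TG l)
    (ΓΘ : DTh l ≃* DTh l)
    (hYuu : (PiYddT l ⊓ (monodromyModel l hl).tp (monodromyModel l hl).PiXuu).map Γ.toMulEquiv.toMonoidHom =
      PiYddT l ⊓ (monodromyModel l hl).tp (monodromyModel l hl).PiXuu) :
    (thetaOrbitData l hl).transport _ Γ hYuu ΓΘ (rootColl l hl) = rootColl l hl := by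
  unfold ThetaOrbitData.transport rootColl
  rw [Set.image_singleton, Set.image_singleton, Set.singleton_eq_singleton_iff, Set.singleton_eq_singleton_iff]
  funext g
  show ΓΘ.symm (thetaCoeff l 1) = thetaCoeff l 1
  rw [thetaCoeff_one, map_one]

/-- **Cor. 2.8 (i), clause C2 (roots, order `l`), for EVERY `Γ`** at the toy — DEGENERATE (`Π^tp_{Ÿ̲̲} = 1`): the root
collection is carried to itself, `κ = 1`. (toy bookkeeping; no claim about print) [cite: MochizukiEtTh2009, Cor 2.8(i) p.42] -/
theorem cor28_i_C2 (Γ : TG l ≃ₜ* TG l) (ΓΘ : DTh l ≃* DTh l)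
    (hYuu : (PiYddT l ⊓ (monodromyModel l hl).tp (monodromyModel l hl).PiXuu).map Γ.toMulEquiv.toMonoidHom =
      PiYddT l ⊓ (monodromyModel l hl).tp (monodromyModel l hl).PiXuu) :
    (thetaOrbitData l hl).EqUpToRootOfUnity l _ (thetaOrbitData l hl).rootLZMu2
      ((thetaOrbitData l hl).transport _ Γ hYuu ΓΘ (thetaOrbitData l hl).rootLZMu2) :=
  EqUpToRootOfUnity.of_eq (transport_rootColl_eq l hl Γ ΓΘ hYuu)

/-- **Cor. 2.8 (i), clause C3 (`η̈^{Θ,ℤ×μ₂}`, order `1`), for EVERY `Γ`** at the toy: if `Γ_Θ` is `Γ`-induced and `Γ`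
stabilises `Π^tp_Ÿ`, then `η̈^{Θ,ℤ×μ₂}` is preserved up to a root of unity of order `1` — indeed EXACTLY (`κ = 1`,
`transport_etaColl_eq`). The tower-stability antecedent of the typed clause is not needed. (toy bookkeeping for [EtTh]
Cor. 2.8 (i); no claim about print) [cite: MochizukiEtTh2009, Cor 2.8(i) p.42] -/
theorem cor28_i_C3 {Γ : TG l ≃ₜ* TG l} {ΓΘ : DTh l ≃* DTh l}
    (hind : (thetaOrbitData l hl).InducesOnTheta Γ ΓΘ) (hY : (PiYddT l).map Γ.toMulEquiv.toMonoidHom = PiYddT l) :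
    (thetaOrbitData l hl).EqUpToRootOfUnity 1 _ (thetaOrbitData l hl).etaZMu2
      ((thetaOrbitData l hl).transport _ Γ hY ΓΘ (thetaOrbitData l hl).etaZMu2) :=
  EqUpToRootOfUnity.of_eq (transport_etaColl_eq l hl hind hY)

/-- **Cor. 2.8 (i) AT THE MONODROMY TOY, clauses C1–C3 for EVERY topological `Γ`** (every odd `l`): the print-recipe datum
is of standard type, and for every `Γ` with an induced `Γ_Θ` permuting `Dtau` — with NO tower-stability hypothesis — the
transported `η̈^{Θ,ℤ×μ₂}` is of standard type (C1), the roots agree up to order `l` (C2, degenerate) and `η̈^{Θ,ℤ×μ₂}` is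
preserved EXACTLY (C3). The typed `Cor28_i` is this plus clause C4, which FAILS (`not_cor28_i`). HONEST LABEL: R1352
DESIGNED TOY; consistency evidence about the TYPED interface only. [cite: MochizukiEtTh2009, Cor 2.8(i) p.42] -/
theorem cor28_i_clauses_C1_C2_C3 :
    (thetaOrbitData l hl).IsStandard ∧
    ∀ (Γ : TG l ≃ₜ* TG l) (ΓΘ : DTh l ≃* DTh l),
      (thetaOrbitData l hl).InducesOnTheta Γ ΓΘ →
      (∀ D ∈ (thetaOrbitData l hl).Dtau, D.map Γ.toMulEquiv.toMonoidHom ∈ (thetaOrbitData l hl).Dtau) →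
      ∀ (hY : (PiYddT l).map Γ.toMulEquiv.toMonoidHom = PiYddT l)
        (hYuu : (PiYddT l ⊓ (monodromyModel l hl).tp (monodromyModel l hl).PiXuu).map Γ.toMulEquiv.toMonoidHom =
          PiYddT l ⊓ (monodromyModel l hl).tp (monodromyModel l hl).PiXuu),
      (thetaOrbitData l hl).IsStandardColl ((thetaOrbitData l hl).transport _ Γ hY ΓΘ (thetaOrbitData l hl).etaZMu2) ∧
      (thetaOrbitData l hl).EqUpToRootOfUnity l _ (thetaOrbitData l hl).rootLZMu2
        ((thetaOrbitData l hl).transport _ Γ hYuu ΓΘ (thetaOrbitData l hl).rootLZMu2) ∧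
      (thetaOrbitData l hl).EqUpToRootOfUnity 1 _ (thetaOrbitData l hl).etaZMu2
        ((thetaOrbitData l hl).transport _ Γ hY ΓΘ (thetaOrbitData l hl).etaZMu2) :=
  ⟨isStandard_thetaOrbitData l hl, fun Γ ΓΘ hind hD hY hYuu =>
    ⟨cor28_i_C1 l hl hind hD hY, cor28_i_C2 l hl Γ ΓΘ hYuu, cor28_i_C3 l hl hind hY⟩⟩

/-! ## 5. Clause C4 FAILS for `γ_t`; `¬ Cor28_i` at the toy datum -/

/-- `γ_t` stabilises `Π^tp_Ÿ` (normal). (toy bookkeeping) [cite: MochizukiEtTh2009, Def 2.5 p.39] -/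
theorem map_innerAutTop_tT_PiYddT :
    (PiYddT l).map (innerAutTop (T := monodromyModel l hl) (tT l)).toMulEquiv.toMonoidHom = PiYddT l := by
  haveI := PiYddT_normal l
  exact map_innerAutTop_eq_of_normal (T := monodromyModel l hl) (PiYddT l) (tT l)

/-- `γ_t` stabilises `Π^tp_{Ÿ̲̲} = 1`. (toy bookkeeping) [cite: MochizukiEtTh2009, Def 2.7 p.41] -/
theorem map_innerAutTop_tT_PiYdduu :
    (PiYddT l ⊓ (monodromyModel l hl).tp (monodromyModel l hl).PiXuu).map
        (innerAutTop (T := monodromyModel l hl) (tT l)).toMulEquiv.toMonoidHom =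
      PiYddT l ⊓ (monodromyModel l hl).tp (monodromyModel l hl).PiXuu := by
  rw [PiYddT_inf_tp_PiXuu_eq_bot l hl, Subgroup.map_bot]

/-- **`γ_t` stabilises the whole `C̲`-list `[Π^tp_{C̲}, Π^tp_{X̲}, Π^tp_X, Π^tp_Ÿ]`** of the typed clause C4 (`t` lies in the
first three; `Π^tp_Ÿ` is normal) — in print `t` does not even normalise `Π_{C̲}` (Rmk. 2.1.1). (toy bookkeeping for
[EtTh] Cor. 2.8 (i); no claim about print) [cite: MochizukiEtTh2009, Rmk 2.1.1 p.36] -/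
theorem innerAutTop_tT_stabilises_CuList :
    ∀ S ∈ [(monodromyModel l hl).tp (monodromyModel l hl).PiCu, (monodromyModel l hl).tp (monodromyModel l hl).PiXu,
      (monodromyModel l hl).tp (monodromyModel l hl).PiX, (monodromyModel l hl).PiYddtp],
      S.map (innerAutTop (T := monodromyModel l hl) (tT l)).toMulEquiv.toMonoidHom = S := by
  intro S hS
  simp only [List.mem_cons, List.not_mem_nil, or_false] at hS
  rcases hS with rfl | rfl | rfl | rfl
  · rw [tp_PiCu l hl]
    exact map_innerAutTop_of_mem (tT_mem l).1
  · rw [tp_PiXu l hl]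
    exact map_innerAutTop_of_mem (tT_mem l).2.1
  · rw [tp_PiX l hl]
    exact map_innerAutTop_of_mem (tT_mem l).2.2
  · exact map_innerAutTop_tT_PiYddT l hl

/-- `γ_t` permutes `Dtau = {1}`. (toy bookkeeping) [cite: MochizukiEtTh2009, Def 1.9 p.29] -/
theorem innerAutTop_tT_Dtau : ∀ D ∈ (thetaOrbitData l hl).Dtau,
    D.map (innerAutTop (T := monodromyModel l hl) (tT l)).toMulEquiv.toMonoidHom ∈ (thetaOrbitData l hl).Dtau := by
  intro D hD
  have hD' : D = ⊥ := hD
  rw [hD', Subgroup.map_bot]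
  exact Set.mem_singleton _

/-- `η_{1,1} ∉ {η₀, η₀⁻¹}`: the one-step translate of the toy theta class is neither `η₀` nor `η₀⁻¹` (evaluate at `x₀`;
needs `l ≠ 1`). (toy bookkeeping) [cite: MochizukiEtTh2009, Def 2.7 p.41] -/
theorem etaFn_one_one_ne (hl1 : l ≠ 1) : etaFn l 1 1 ≠ etaFn l 1 0 ∧ etaFn l 1 1 ≠ etaFn l (-1) 0 := by
  haveI : Fact (1 < l) := ⟨lt_of_le_of_ne (Nat.one_le_iff_ne_zero.mpr (NeZero.ne l)) (Ne.symm hl1)⟩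
  have key : ∀ ε : ZMod l, etaFn l 1 1 ≠ etaFn l ε 0 := by
    intro ε h
    have hx := congrFun h ⟨xT l, xT_mem l⟩
    rw [etaFn_apply, etaFn_apply] at hx
    have hx' : (1 : ZMod l) * 0 + 1 * 1 = ε * 0 + 0 * 1 := Multiplicative.ofAdd.injective (thetaCoeff_injective l hx)
    rw [mul_zero, zero_add, mul_one, mul_zero, zero_mul, add_zero] at hx'
    exact one_ne_zero hx'
  exact ⟨key 1, key (-1)⟩

/-- **`γ_t` moves `η̈^{Θ,l·ℤ×μ₂} = {η₀, η₀⁻¹}`**: its transport along `(γ_t, Γ_Θ)` (any induced `Γ_Θ` — it is the identity,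
`z` being central) contains `η_{1,1} = η₀ ∘ γ_t ∉ {η₀^{±1}}`. (toy bookkeeping for [EtTh] Cor. 2.8 (i) clause «`C̲`»; no
claim about print) [cite: MochizukiEtTh2009, Cor 2.8(i) p.42] -/
theorem transport_innerAutTop_tT_etaCollL_ne (hl1 : l ≠ 1)
    {ΓΘ : DTh l ≃* DTh l}
    (hind : (thetaOrbitData l hl).InducesOnTheta (innerAutTop (T := monodromyModel l hl) (tT l)) ΓΘ)
    (hY : (PiYddT l).map (innerAutTop (T := monodromyModel l hl) (tT l)).toMulEquiv.toMonoidHom = PiYddT l) :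
    (thetaOrbitData l hl).transport (PiYddT l) (innerAutTop (T := monodromyModel l hl) (tT l)) hY ΓΘ (etaCollL l) ≠
      etaCollL l := by
  have hΓΘ : ∀ a, ΓΘ.symm a = a := fun a => by
    rw [MulEquiv.symm_apply_eq, (thetaOrbitData l hl).inducesOnTheta_innerAutTop_eq_act hind, act_eq_self]
  intro h
  have hmem : {etaFn l 1 1} ∈
      (thetaOrbitData l hl).transport (PiYddT l) (innerAutTop (T := monodromyModel l hl) (tT l)) hY ΓΘ (etaCollL l) := by
    refine ⟨{etaFn l 1 0}, Or.inl rfl, ?_⟩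
    beta_reduce
    rw [Set.image_singleton, Set.singleton_eq_singleton_iff]
    funext g
    rw [hΓΘ]
    have h01 := etaFn_one_conj_tT l 0 g
    rw [zero_add] at h01
    exact h01
  rw [h] at hmem
  rcases hmem with h1 | h1
  · exact (etaFn_one_one_ne l hl1).1 (Set.singleton_eq_singleton_iff.mp h1)
  · exact (etaFn_one_one_ne l hl1).2 (Set.singleton_eq_singleton_iff.mp (Set.mem_singleton_iff.mp h1))

/-- **Clause C4 of the typed Cor. 2.8 (i) FAILS at the toy for `γ_t`**: «`η̈^{Θ,l·ℤ×μ₂}` preserved up to a root of unity of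
order `1`» means literal equality here (abc-iut-f-161's `EqUpToRootOfUnity.eq_of_one`: `Δ_Θ` commutative, singleton
classes `∂`-saturated since the action on `Δ_Θ` is trivial), and `γ_t` moves the collection. (toy bookkeeping for [EtTh]
Cor. 2.8 (i); no claim about print) [cite: MochizukiEtTh2009, Cor 2.8(i) p.42] -/
theorem not_cor28_i_C4 (hl1 : l ≠ 1) {ΓΘ : DTh l ≃* DTh l}
    (hind : (thetaOrbitData l hl).InducesOnTheta (innerAutTop (T := monodromyModel l hl) (tT l)) ΓΘ)
    (hY : (PiYddT l).map (innerAutTop (T := monodromyModel l hl) (tT l)).toMulEquiv.toMonoidHom = PiYddT l) :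
    ¬ (thetaOrbitData l hl).EqUpToRootOfUnity 1 _ (thetaOrbitData l hl).etaLZMu2
      ((thetaOrbitData l hl).transport _ (innerAutTop (T := monodromyModel l hl) (tT l)) hY ΓΘ
        (thetaOrbitData l hl).etaLZMu2) := by
  intro h
  refine transport_innerAutTop_tT_etaCollL_ne l hl hl1 hind hY (EqUpToRootOfUnity.eq_of_one (deltaTheta_comm l) ?_ h)
  intro c hc η hη d
  have hfun : (fun g : ↥(PiYddT l) => η g * ((thetaOrbitData l hl).act (g : TG l) d * d⁻¹)) = η := by
    funext g
    rw [act_eq_self, mul_inv_cancel, mul_one]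
  rw [hfun]
  exact hη

/-- **`¬ Cor28_i` AT THE MONODROMY TOY** (every odd `l ≠ 1`): the print-recipe orbit datum of part A is of standard type and
satisfies clauses C1–C3 for every `Γ`, but VIOLATES clause C4 of the typed [EtTh] Cor. 2.8 (i) — `γ_t` (conjugation by the
loop) stabilises the typed `C̲`-list, induces the identity on `Δ_Θ`, permutes `Dtau`, and translates `η₀` out of
`η̈^{Θ,l·ℤ×μ₂} = {η₀^{±1}}`.  DIAGNOSIS: `not_def25Conditions` — Def. 2.5 (i)(a) fails at the toy, so Rmk. 2.1.1's
obstruction (translation by `t` does not normalise `Π_{C̲}`) is absent; the typed `Cor28_i` carries no Def. 2.5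
hypothesis.  A NEGATIVE instance of OUR typed predicate at a DESIGNED toy (next to abc-iut-w4-d051's `not_forall_cor28_i`);
refutable-as-typed-at-a-design-carrier ≠ refuted in print; no side taken; typed ≠ proved.
[cite: MochizukiEtTh2009, Cor 2.8(i) p.42] -/
theorem not_cor28_i (hl1 : l ≠ 1) : ¬ (thetaOrbitData l hl).Cor28_i := by
  intro h
  obtain ⟨ΓΘ, hind, -⟩ := (thetaOrbitData l hl).exists_inducesOnTheta_innerAutTop (tT l)
  have h4 := (h (isStandard_thetaOrbitData l hl) _ ΓΘ hind (innerAutTop_tT_Dtau l hl)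
    (map_innerAutTop_tT_PiYddT l hl) (map_innerAutTop_tT_PiYdduu l hl)).2.2.2 (innerAutTop_tT_stabilises_CuList l hl)
  exact not_cor28_i_C4 l hl hl1 hind (map_innerAutTop_tT_PiYddT l hl) h4

/-- **Both signs over the SAME interface, recorded together**: the ∀-closure of `Cor28_i` is refuted by a junk collection
(abc-iut-w4-d051) AND by print's recipe at a designed toy (this file), while the saturated datum satisfies it
(abc-iut-f-128 `cor28_i_saturate`) — F-0640 is a schema whose truth value depends on data the interface leaves free.
[cite: MochizukiEtTh2009, Cor 2.8(i) p.42] -/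
theorem cor28_i_schema_both_signs (hl1 : l ≠ 1) :
    (∃ O : ThetaOrbitData (monodromyModel l hl), O.IsStandard ∧ ¬ O.Cor28_i) ∧
      ∃ O : ThetaOrbitData (monodromyModel l hl), O.IsStandard ∧ O.Cor28_i :=
  ⟨⟨thetaOrbitData l hl, isStandard_thetaOrbitData l hl, not_cor28_i l hl hl1⟩,
    ⟨(thetaOrbitData l hl).saturate, (thetaOrbitData l hl).isStandard_saturate, (thetaOrbitData l hl).cor28_i_saturate⟩⟩

/-! ## 6. The diagnosis: Def. 2.5 (i)(a) fails at the monodromy toy -/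

/-- **Def. 2.5 (i)(a) `Π^tp_Y ⊆ Π^tp_{X̲}` FAILS at the monodromy toy** (for every parameter `IsPmCompatible`): `x₀ ∈ Π^tp_Y`
has `b = 1 ≠ 0`, while `Π^tp_{X̲} = {b = 0, d rotation}` — the toy's `X̲ → X` kills the `a`-cycle instead of the loop
(abc-iut-w6-d084's own label), which is why translation by `t` survives inside `Π^tp_{C̲}` and clause C4 fails.
(toy bookkeeping for [EtTh] Def. 2.5 (i); no claim about print) [cite: MochizukiEtTh2009, Def 2.5 p.39] -/
theorem not_def25Conditions (hl1 : l ≠ 1) (P : Subgroup (monodromyModel l hl).PiC → Prop) :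
    ¬ (monodromyModel l hl).Def25Conditions P := by
  haveI : Fact (1 < l) := ⟨lt_of_le_of_ne (Nat.one_le_iff_ne_zero.mpr (NeZero.ne l)) (Ne.symm hl1)⟩
  rintro ⟨h, -⟩
  have hx : xT l ∈ (monodromyModel l hl).PiYtp := (mem_PiYT l).mpr rfl
  have h2 := h hx
  rw [tp_PiXu l hl] at h2
  have h3 : bC l (xT l) = 0 := (mem_comap_PhiT_heisB0 l).mp (Subgroup.mem_inf.mp (Subgroup.mem_comap.mp h2)).1
  exact one_ne_zero h3

end Model

end Literature.AnabelianGeometry.EtaleTheta.ThetaCovers.MonodromyModel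

end
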